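import Mathlib
import HarnessLib

/-!
# Toward R-S1ℓ `LukacsOneDim` (LINE g21-B / forward-cone rungs, crux ⟨stmt-QuantumFields-23125⟩): the algebra of symmetric differences

Free-hands helper of width seat `ym-line-sfw-p2-w3` (g37, cell `ym-idea-1`).  The derivative-free route to Lukacs' theorem («analytic cosine
transform ⇒ exponential moment») reads the even moments off SYMMETRIC DIFFERENCES of the cosine transform: for a finite measure `m`,
`∫ (2 sin(hq/2))^{2k} dm = (−1)^k Σ_{j ≤ 2k} (−1)^j C(2k,j) φ((j − k)h)`, `φ(s) = ∫ cos(sq) dm`.  This file proves the two algebraic inputs: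

* `two_sub_two_cos_pow_eq_sum` — `(2 − 2cos x)^k = (−1)^k Σ_{j=0}^{2k} (−1)^j C(2k,j) cos((j − k)x)` (real part of the binomial expansion of
  `(e^{ix/2} − e^{−ix/2})^{2k} = (2i sin(x/2))^{2k}`);
* `sum_neg_one_pow_choose_mul_sub_pow_eq_zero` / `…_eq_factorial` — the `2k`-th difference annihilates polynomials of degree `< 2k` and gives
  `(2k)!` on degree `2k` (Mathlib `fwdDiff`), and the crude bound `|Σ_j (−1)^j C(2k,j)(j − k)^n| ≤ 4^k k^n`.

HONEST LABEL: elementary algebra toward an OPEN rung; nothing of S1/⟨23125⟩/⟨23035⟩/R2d is proved; the Yang–Mills mass gap is NOT proved.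
-/

set_option autoImplicit false

noncomputable section

namespace Summit.QuantumFields.YangMills.Theorems.F4SubCurvatureDoorForwardConeLukacs

open Finset Complex
open scoped BigOperators Real

/-! ## The trigonometric identity -/

/-- `e^{iy} − e^{−iy} = 2i sin y` in `ℂ`. -/
theorem cexp_sub_cexp (y : ℂ) : cexp (y * I) - cexp (-(y * I)) = 2 * I * Complex.sin y := by
  rw [Complex.sin, show -y * I = -(y * I) by ring]
  have hI : I * I = -1 := Complex.I_mul_I
  linear_combination (cexp (y * I) - cexp (-(y * I))) * hI

/-- The binomial expansion `(e^{ix/2} − e^{−ix/2})^{2k} = Σ_{j=0}^{2k} (−1)^j C(2k,j) e^{i(j−k)x}`. -/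
theorem cexp_sub_pow_eq_sum (x : ℝ) (k : ℕ) :
    (cexp ((x / 2 : ℝ) * I) - cexp (-((x / 2 : ℝ) * I))) ^ (2 * k) =
      ∑ j ∈ range (2 * k + 1), (-1 : ℂ) ^ j * ((2 * k).choose j : ℂ) * cexp ((((j : ℝ) - k) * x : ℝ) * I) := by
  rw [sub_eq_add_neg, add_pow]
  refine Finset.sum_congr rfl fun j hj => ?_
  have hjle : j ≤ 2 * k := Nat.lt_succ_iff.1 (Finset.mem_range.1 hj)
  rw [neg_pow, ← Complex.exp_nat_mul, ← Complex.exp_nat_mul]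
  have hsign : (-1 : ℂ) ^ (2 * k - j) = (-1) ^ j := by
    have h1 : (-1 : ℂ) ^ (2 * k - j) * (-1) ^ j = 1 := by
      rw [← pow_add, Nat.sub_add_cancel hjle, pow_mul]; norm_num
    have h2 : (-1 : ℂ) ^ j * (-1) ^ j = 1 := by rw [← pow_add, ← two_mul, pow_mul]; norm_num
    calc (-1 : ℂ) ^ (2 * k - j) = (-1) ^ (2 * k - j) * ((-1) ^ j * (-1) ^ j) := by rw [h2, mul_one]
      _ = ((-1) ^ (2 * k - j) * (-1) ^ j) * (-1) ^ j := by ring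
      _ = (-1) ^ j := by rw [h1, one_mul]
  rw [hsign]
  have hexp : cexp ((j : ℕ) * (((x / 2 : ℝ) : ℂ) * I)) * cexp (((2 * k - j : ℕ) : ℂ) * -(((x / 2 : ℝ) : ℂ) * I)) =
      cexp (((((j : ℝ) - k) * x : ℝ) : ℂ) * I) := by
    rw [← Complex.exp_add]
    congr 1
    push_cast [Nat.cast_sub hjle]
    ring
  calc cexp (↑j * (↑(x / 2 : ℝ) * I)) * ((-1) ^ j * cexp (↑(2 * k - j) * -(↑(x / 2 : ℝ) * I))) * ↑((2 * k).choose j)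
      = (-1) ^ j * ↑((2 * k).choose j) * (cexp (↑j * (↑(x / 2 : ℝ) * I)) * cexp (↑(2 * k - j) * -(↑(x / 2 : ℝ) * I))) := by ring
    _ = (-1) ^ j * ↑((2 * k).choose j) * cexp (((((j : ℝ) - k) * x : ℝ) : ℂ) * I) := by rw [hexp]

/-- **`(2 − 2cos x)^k = (−1)^k Σ_{j=0}^{2k} (−1)^j C(2k,j) cos((j − k)x)`.** -/
theorem two_sub_two_cos_pow_eq_sum (x : ℝ) (k : ℕ) :
    (2 - 2 * Real.cos x) ^ k = (-1) ^ k * ∑ j ∈ range (2 * k + 1), (-1 : ℝ) ^ j * ((2 * k).choose j : ℝ) * Real.cos (((j : ℝ) - k) * x) := by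
  -- real part of the complex identity
  have hC := cexp_sub_pow_eq_sum x k
  rw [cexp_sub_cexp, mul_pow, mul_pow, pow_mul I, Complex.I_sq] at hC
  -- `(2^{2k} (−1)^k sin(x/2)^{2k})` is the left side
  have hre := congrArg Complex.re hC
  rw [Complex.re_sum] at hre
  -- `2 − 2cos x = 4 sin²(x/2)` (also in the tree as `…ConstrainedBiLaplacianBloch1D.two_sub_two_mul_cos`; inlined to keep imports Mathlib-only)
  have two_sub_two_cos : 2 - 2 * Real.cos x = 4 * Real.sin (x / 2) ^ 2 := by
    rw [Real.sin_sq_eq_half_sub, show 2 * (x / 2) = x by ring]; ring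
  have hL : ((2 : ℂ) ^ (2 * k) * (-1) ^ k * Complex.sin ((x / 2 : ℝ) : ℂ) ^ (2 * k)).re =
      (-1) ^ k * (2 - 2 * Real.cos x) ^ k := by
    rw [← Complex.ofReal_sin, ← Complex.ofReal_pow, show ((2 : ℂ) ^ (2 * k) * (-1) ^ k) = (((2 : ℝ) ^ (2 * k) * (-1) ^ k : ℝ) : ℂ) by push_cast; ring,
      ← Complex.ofReal_mul, Complex.ofReal_re, two_sub_two_cos, mul_pow, ← pow_mul, show (4 : ℝ) ^ k = 2 ^ (2 * k) by
        rw [pow_mul]; norm_num]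
    ring
  have hR : ∀ j ∈ range (2 * k + 1), ((-1 : ℂ) ^ j * ((2 * k).choose j : ℂ) * cexp ((((j : ℝ) - k) * x : ℝ) * I)).re =
      (-1 : ℝ) ^ j * ((2 * k).choose j : ℝ) * Real.cos (((j : ℝ) - k) * x) := by
    intro j _
    rw [show ((-1 : ℂ) ^ j * ((2 * k).choose j : ℂ)) = ((((-1 : ℝ) ^ j * ((2 * k).choose j : ℝ)) : ℝ) : ℂ) by push_cast; ring,
      Complex.re_ofReal_mul, Complex.exp_ofReal_mul_I_re]
  rw [hL, Finset.sum_congr rfl hR] at hre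
  have h1 : ((-1 : ℝ) ^ k) * ((-1) ^ k) = 1 := by rw [← pow_add, ← two_mul, pow_mul]; norm_num
  calc (2 - 2 * Real.cos x) ^ k = ((-1 : ℝ) ^ k * (-1) ^ k) * (2 - 2 * Real.cos x) ^ k := by rw [h1, one_mul]
    _ = (-1) ^ k * ((-1) ^ k * (2 - 2 * Real.cos x) ^ k) := by ring
    _ = (-1) ^ k * ∑ j ∈ range (2 * k + 1), (-1 : ℝ) ^ j * ((2 * k).choose j : ℝ) * Real.cos (((j : ℝ) - k) * x) := by rw [hre]

/-! ## The symmetric differences of powers -/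

/-- The `N`-th difference annihilates `(r − c)^n` for `n < N`: `Σ_{j=0}^{N} (−1)^{N−j} C(N,j) (j − c)^n = 0`. -/
theorem sum_choose_mul_sub_pow_eq_zero (N n : ℕ) (hn : n < N) (c : ℝ) :
    ∑ j ∈ range (N + 1), ((-1 : ℤ) ^ (N - j) * (N.choose j : ℤ)) • ((j : ℝ) - c) ^ n = 0 := by
  have h := fwdDiff_iter_eq_sum_shift (h := (1 : ℝ)) (fun r : ℝ => (r - c) ^ n) N 0
  simp only [zero_add, nsmul_eq_mul, mul_one] at h
  have hP : (fun r : ℝ => (r - c) ^ n) = (Polynomial.eval · ((Polynomial.X - Polynomial.C c) ^ n)) := by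
    funext r; simp
  have hdeg : ((Polynomial.X - Polynomial.C c) ^ n : Polynomial ℝ).natDegree < N := by
    rw [Polynomial.natDegree_pow, Polynomial.natDegree_X_sub_C, mul_one]; exact hn
  have hz := congrFun (Polynomial.fwdDiff_iter_eq_zero_of_degree_lt (R := ℝ) hdeg) 0
  rw [← hP, h] at hz
  simpa [smul_eq_mul] using hz

/-- The `N`-th difference of `(r − c)^N` is `N!`: `Σ_{j=0}^{N} (−1)^{N−j} C(N,j) (j − c)^N = N!`. -/
theorem sum_choose_mul_sub_pow_eq_factorial (N : ℕ) (c : ℝ) :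
    ∑ j ∈ range (N + 1), ((-1 : ℤ) ^ (N - j) * (N.choose j : ℤ)) • ((j : ℝ) - c) ^ N = (N.factorial : ℝ) := by
  have h := fwdDiff_iter_eq_sum_shift (h := (1 : ℝ)) (fun r : ℝ => (r - c) ^ N) N 0
  simp only [zero_add, nsmul_eq_mul, mul_one] at h
  have h2 : (fwdDiff (1 : ℝ))^[N] (fun r : ℝ => (r - c) ^ N) 0 = (N.factorial : ℝ) := by
    have h3 := fwdDiff_iter_comp_add (h := (1 : ℝ)) (fun s : ℝ => s ^ N) (-c) N 0
    simp only [← sub_eq_add_neg] at h3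
    rw [h3, fwdDiff_iter_eq_factorial]
    simp
  rw [← h, h2]

/-- For `j ≤ 2k`: `(−1)^{2k−j} = (−1)^j`. -/
theorem neg_one_pow_two_mul_sub {k j : ℕ} (hj : j ≤ 2 * k) : ((-1 : ℤ) ^ (2 * k - j)) = (-1) ^ j := by
  have : (-1 : ℤ) ^ (2 * k - j) * (-1) ^ j = 1 := by
    rw [← pow_add, Nat.sub_add_cancel hj, pow_mul]; norm_num
  have hsq : ((-1 : ℤ) ^ j) * ((-1) ^ j) = 1 := by rw [← pow_add, ← two_mul, pow_mul]; norm_num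
  calc (-1 : ℤ) ^ (2 * k - j) = (-1) ^ (2 * k - j) * ((-1) ^ j * (-1) ^ j) := by rw [hsq, mul_one]
    _ = ((-1) ^ (2 * k - j) * (-1) ^ j) * (-1) ^ j := by ring
    _ = (-1) ^ j := by rw [this, one_mul]

/-- **Vanishing**: `Σ_{j=0}^{2k} (−1)^j C(2k,j) (j − k)^n = 0` for `n < 2k`. -/
theorem symmDiff_pow_eq_zero (k n : ℕ) (hn : n < 2 * k) :
    ∑ j ∈ range (2 * k + 1), (-1 : ℝ) ^ j * ((2 * k).choose j : ℝ) * ((j : ℝ) - k) ^ n = 0 := by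
  have h := sum_choose_mul_sub_pow_eq_zero (2 * k) n hn (k : ℝ)
  rw [← h]
  refine Finset.sum_congr rfl fun j hj => ?_
  have hjle : j ≤ 2 * k := Nat.lt_succ_iff.1 (Finset.mem_range.1 hj)
  rw [neg_one_pow_two_mul_sub hjle, zsmul_eq_mul]
  push_cast
  ring

/-- **Top degree**: `Σ_{j=0}^{2k} (−1)^j C(2k,j) (j − k)^{2k} = (2k)!`. -/
theorem symmDiff_pow_eq_factorial (k : ℕ) :
    ∑ j ∈ range (2 * k + 1), (-1 : ℝ) ^ j * ((2 * k).choose j : ℝ) * ((j : ℝ) - k) ^ (2 * k) = ((2 * k).factorial : ℝ) := by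
  have h := sum_choose_mul_sub_pow_eq_factorial (2 * k) (k : ℝ)
  rw [← h]
  refine Finset.sum_congr rfl fun j hj => ?_
  have hjle : j ≤ 2 * k := Nat.lt_succ_iff.1 (Finset.mem_range.1 hj)
  rw [neg_one_pow_two_mul_sub hjle, zsmul_eq_mul]
  push_cast
  ring

/-- **Crude bound**: `|Σ_{j=0}^{2k} (−1)^j C(2k,j) (j − k)^n| ≤ 4^k k^n`. -/
theorem abs_symmDiff_pow_le (k n : ℕ) :
    |∑ j ∈ range (2 * k + 1), (-1 : ℝ) ^ j * ((2 * k).choose j : ℝ) * ((j : ℝ) - k) ^ n| ≤ (4 : ℝ) ^ k * (k : ℝ) ^ n := by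
  refine (Finset.abs_sum_le_sum_abs _ _).trans ?_
  have hterm : ∀ j ∈ range (2 * k + 1), |(-1 : ℝ) ^ j * ((2 * k).choose j : ℝ) * ((j : ℝ) - k) ^ n| ≤
      ((2 * k).choose j : ℝ) * (k : ℝ) ^ n := by
    intro j hj
    have hjle : j ≤ 2 * k := Nat.lt_succ_iff.1 (Finset.mem_range.1 hj)
    rw [abs_mul, abs_mul, abs_pow, abs_neg, abs_one, one_pow, one_mul, Nat.abs_cast, abs_pow]
    refine mul_le_mul_of_nonneg_left (pow_le_pow_left₀ (abs_nonneg _) ?_ n) (Nat.cast_nonneg _)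
    rw [abs_le]
    have : (j : ℝ) ≤ 2 * k := by exact_mod_cast hjle
    constructor <;> linarith
  refine (Finset.sum_le_sum hterm).trans (le_of_eq ?_)
  rw [← Finset.sum_mul]
  congr 1
  have := Nat.sum_range_choose (2 * k)
  rw [show (4 : ℝ) ^ k = ((2 ^ (2 * k) : ℕ) : ℝ) by rw [pow_mul]; norm_num, ← this]
  push_cast
  rfl

end Summit.QuantumFields.YangMills.Theorems.F4SubCurvatureDoorForwardConeLukacs

end
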